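/-
Copyright: the b2b-balaban T⁴-continuum CRUX team, row NE7b leaf lineage `t4-ne7b-formalise-leaf-03` (gen 147). Project licence.
-/
import Mathlib.Analysis.InnerProductSpace.LaxMilgram
import Mathlib.Analysis.Normed.Operator.Basic
import Mathlib.Tactic.Positivity
import Mathlib.Tactic.FieldSimp
import Mathlib.Tactic.Linarith

/-!
# THE LINEARISED HARD STEP — THE BACKGROUND PROPAGATOR `H` OF A FORM COERCIVE ON `ker D` ONLY: for a bounded bilinear form `Q`
# on a real Hilbert space `E` with `m‖κ‖² ≤ Q κ κ` on `ker D` (nothing asked off the kernel) and a constraint `D : E →L F` with a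
# right inverse `M`, every fibre `{D x = k}` carries a UNIQUE point `H k` that is `Q`-orthogonal to `ker D`; `H` is a bounded LINEAR
# right inverse of `D`, INDEPENDENT of `M`, with `‖H k‖ ≤ (1 + ‖Q‖∕m)‖M k‖`; for symmetric `Q ≥ 0` on `ker D` it is the fibre
# MINIMISER of `x ↦ Q x x`; and `x = (x − H D x) + H D x` is the `Q`-orthogonal splitting `E = ker D ⊕ range H` — print's chart
# «`A = A′ − H D(A′)`» ([B11] (47)) in abstract currency (row NE7b, node U5c; TRANSFER rows (ix)∕(xxiv), idea-1 T-93 (b) «[B11] chart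
# (47) … = the IFT section σ with N = H», T-92 «Thm 3.12: `G₁⁻¹ > 0` on the gauge-fixed slice»; [folklore]: Lax–Milgram on a closed
# subspace)

Cell `pub-balaban`, sub-cell `t4`, spine estimate NE7b (`T4WeightBudget.RelWeightBound`; NOT PRINTED in [Bałaban 1983–89],
NOT PROVED).  Crux-route work under `Spine/NE7b/` by leaf-03 (CRUX team (2), FREEZE (0) crux-prover clause).  NOTHING of
Bałaban's is named, asserted, valued or discharged.  Mathlib only (`InnerProductSpace.LaxMilgram`); no `def`; zero `sorry`.

WHY.  The hard step's background field `w ↦ δ(w)` (the fibre minimiser of the action) is `Cⁿ` by `ConstrainedMinimiserRegular`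
(CMR) when the Hessian is non-degenerate, Lipschitz from the first-order letters by `HardStepBackgroundLipschitz` (HSBL).  Its
LINEARISATION — the map `k ↦ δ′(w)k` — is the fibre minimiser of the QUADRATIC form `Q = D²V(δ(w))` on the fibres of `D`, i.e.
print's background propagator `H` (the operator behind `G_k(U)`, [B9] Sect. D; the chart `A = A′ − H D(A′)` of [B11] (47)).
Print's positivity input is Thm 3.12: the Hessian is positive ON THE SLICE — on `ker D` — and nowhere is positivity off the
kernel used.  This file isolates exactly that: coercivity on `ker D` ALONE already gives existence, uniqueness, linearity,
`M`-independence and the bound of `H`, by Lax–Milgram on the closed subspace `ker D`; symmetry and positivity are needed only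
for the minimising reading.  (HSBL's sharper `√(L∕m)` needs the strong letter transversally; CMR's `δ′` exists in finite
dimension; here: any real Hilbert space, any bounded `Q`.)

WHAT IS PROVED ([folklore]; Lax–Milgram: Mathlib `IsCoercive.continuousLinearEquivOfBilin`).  `E` a real inner-product space
(complete where said), `F` real normed, `Q : E →L[ℝ] E →L[ℝ] ℝ`, `D : E →L[ℝ] F`, `M : F →L[ℝ] E` with `D (M w) = w`, and the
KERNEL COERCIVITY letter `∀ κ, D κ = 0 → m‖κ‖² ≤ Q κ κ` (`0 < m`).
* §1 (algebra, no completeness) `eq_of_orthogonal_ker` — two points of one fibre both `Q`-orthogonal to `ker D` coincide;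
  `le_of_orthogonal_ker` — for SYMMETRIC `Q` with `Q ≥ 0` on `ker D`, a `Q`-orthogonal point minimises `x ↦ Q x x` on its fibre;
  **`norm_le_of_orthogonal_ker`** — a `Q`-orthogonal point `h` of the fibre `k` obeys `‖h‖ ≤ (1 + ‖Q‖∕m)·‖M k‖` for ANY right
  inverse `M` (test the coercivity at `M k − h ∈ ker D`).
* §2 (Lax–Milgram on `ker D`, `E` complete) **`exists_orthogonal_ker`** — every fibre has a `Q`-orthogonal point.
* §3 **`exists_propagator`** — `∃ H : F →L[ℝ] E`, `D ∘ H = id`, `Q (H k) κ = 0` on `ker D`, `‖H k‖ ≤ (1 + ‖Q‖∕m)‖M k‖`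
  (linearity from uniqueness, continuity by `LinearMap.mkContinuous`); `propagator_unique` (hence `M`-independence);
  `opNorm_propagator_le` — `‖H‖ ≤ (1 + ‖Q‖∕m)‖M‖`.
* §4 the chart: `sub_propagator_mem_ker` (`x − H(Dx) ∈ ker D`), `propagator_orthogonal_split` (`Q (H(Dx)) (x − H(Dx)) = 0`),
  `form_split` — symmetric `Q`: `Q x x = Q (HDx)(HDx) + Q (x − HDx)(x − HDx)` (the form SPLITS along `E = range H ⊕ ker D`).
* §5 toy (`example`): `E = F = ℝ`, `D = M = id`, `Q x y = xy`: the fibre `{x = k}` is a point and §1's bound reads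
  `‖k‖ ≤ (1 + ‖Q‖∕1)·‖k‖`.

NOT HERE (honest): which `Q, D` are Bałaban's (the Hessian of the Wilson action at the background on the axial ∕ Landau slice,
[B9] (3.10); (A3) ∕ (A1c), NC-NE7b-α UNRULED); the propagator's DECAY (print's real content, [B9] Thm 3.3 ∕ 3.11 — the NE9
chain's business); indefinite `Q` off the kernel is ALLOWED here but print's is positive; infinite-dimensional minimisers of
the NONLINEAR problem (CVD §6 ∕ CSTF are finite-dimensional).  BY-NAME EFFECT ON THE WALL: NONE.  NE7b NOT PRINTED ∕ NOT PROVED;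
spine PROVED 0∕9; rung (B)+1 on a FINITE torus — NOT infinite volume, NOT the mass gap, NOT Clay.  HONEST DEPENDENCY: continuum
YM on T⁴ ⇐ BetaPertH ∧ nine spine estimates (0/9 proved); BetaPertH ⇐ (D1) ∧ (D4) ∧ CAP+tail; G-an2-4 gates asym, D1 and NE2∕3∕4.
-/

set_option autoImplicit false

namespace Summit.QuantumFields.BalabanUV.T4Continuum.NE7b.QuadraticFibreMinimiser

variable {E F : Type*} [NormedAddCommGroup E] [InnerProductSpace ℝ E] [NormedAddCommGroup F] [NormedSpace ℝ F]

/-! ## §1. Algebra of `Q`-orthogonal fibre points (no completeness) -/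

/-- UNIQUENESS: two points of the same fibre of `D`, both `Q`-orthogonal to `ker D`, coincide when `Q` is coercive on
`ker D`. [folklore] -/
theorem eq_of_orthogonal_ker {Q : E →L[ℝ] E →L[ℝ] ℝ} {D : E →L[ℝ] F} {m : ℝ} (hm : 0 < m)
    (hco : ∀ κ, D κ = 0 → m * ‖κ‖ ^ 2 ≤ Q κ κ) {x y : E} (hD : D x = D y)
    (hx : ∀ κ, D κ = 0 → Q x κ = 0) (hy : ∀ κ, D κ = 0 → Q y κ = 0) : x = y := by
  have hκ : D (x - y) = 0 := by rw [map_sub, hD, sub_self]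
  have h1 := hco _ hκ
  have h2 : Q (x - y) (x - y) = 0 := by
    rw [map_sub Q x y, sub_apply, hx _ hκ, hy _ hκ, sub_self]
  rw [h2] at h1
  have h3 : ‖x - y‖ ^ 2 ≤ 0 := le_of_mul_le_mul_left (by linarith : m * ‖x - y‖ ^ 2 ≤ m * 0) hm
  have h4 : ‖x - y‖ ^ 2 = 0 := le_antisymm h3 (sq_nonneg _)
  exact sub_eq_zero.mp (norm_eq_zero.mp ((pow_eq_zero_iff two_ne_zero).mp h4))

/-- MINIMISATION: for a SYMMETRIC form with `Q κ κ ≥ 0` on `ker D`, a point `h` that is `Q`-orthogonal to `ker D` minimises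
`x ↦ Q x x` on its fibre: `Q h h ≤ Q x x` whenever `D x = D h`. [folklore] -/
theorem le_of_orthogonal_ker {Q : E →L[ℝ] E →L[ℝ] ℝ} {D : E →L[ℝ] F} (hsymm : ∀ x y, Q x y = Q y x)
    (hpos : ∀ κ, D κ = 0 → 0 ≤ Q κ κ) {h x : E} (hD : D x = D h) (horth : ∀ κ, D κ = 0 → Q h κ = 0) :
    Q h h ≤ Q x x := by
  have hκ : D (x - h) = 0 := by rw [map_sub, hD, sub_self]
  have e : Q x x = Q h h + 2 * Q h (x - h) + Q (x - h) (x - h) := by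
    simp only [map_sub, sub_apply]
    rw [hsymm x h]
    ring
  rw [e, horth _ hκ]
  linarith [hpos _ hκ]

/-- **THE BOUND `‖h‖ ≤ (1 + ‖Q‖∕m)·‖M k‖`** for a point `h` of the fibre `k` that is `Q`-orthogonal to `ker D`, `Q` coercive
(`m > 0`) on `ker D`, `M` ANY right inverse of `D`: test the coercivity at `M k − h ∈ ker D`, where
`m‖Mk − h‖² ≤ Q (Mk − h)(Mk − h) = Q (Mk)(Mk − h) ≤ ‖Q‖‖Mk‖‖Mk − h‖`. [folklore] -/
theorem norm_le_of_orthogonal_ker {Q : E →L[ℝ] E →L[ℝ] ℝ} {D : E →L[ℝ] F} {M : F →L[ℝ] E} (hM : ∀ w, D (M w) = w)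
    {m : ℝ} (hm : 0 < m) (hco : ∀ κ, D κ = 0 → m * ‖κ‖ ^ 2 ≤ Q κ κ) {h : E} {k : F} (hD : D h = k)
    (horth : ∀ κ, D κ = 0 → Q h κ = 0) : ‖h‖ ≤ (1 + ‖Q‖ / m) * ‖M k‖ := by
  have hzker : D (M k - h) = 0 := by rw [map_sub, hM, hD, sub_self]
  have h1 : m * ‖M k - h‖ ^ 2 ≤ Q (M k) (M k - h) := by
    have h0 := hco _ hzker
    rw [map_sub Q (M k) h, sub_apply, horth _ hzker, sub_zero] at h0
    exact h0
  have h2 : Q (M k) (M k - h) ≤ ‖Q‖ * ‖M k‖ * ‖M k - h‖ :=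
    calc Q (M k) (M k - h) ≤ ‖Q (M k) (M k - h)‖ := Real.le_norm_self _
      _ ≤ ‖Q (M k)‖ * ‖M k - h‖ := (Q (M k)).le_opNorm _
      _ ≤ ‖Q‖ * ‖M k‖ * ‖M k - h‖ := mul_le_mul_of_nonneg_right (Q.le_opNorm _) (norm_nonneg _)
  have h3 : m * ‖M k - h‖ ≤ ‖Q‖ * ‖M k‖ := by
    by_cases hz0 : ‖M k - h‖ = 0
    · rw [hz0, mul_zero]; positivity
    · have hpos : 0 < ‖M k - h‖ := lt_of_le_of_ne (norm_nonneg _) (Ne.symm hz0)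
      have h4 : m * ‖M k - h‖ * ‖M k - h‖ ≤ ‖Q‖ * ‖M k‖ * ‖M k - h‖ := by
        rw [mul_assoc, ← sq]; exact h1.trans h2
      exact le_of_mul_le_mul_right h4 hpos
  have h5 : ‖M k - h‖ ≤ ‖Q‖ * ‖M k‖ / m := by
    rw [le_div_iff₀ hm]; linarith
  have e : h = M k - (M k - h) := by abel
  calc ‖h‖ = ‖M k - (M k - h)‖ := by rw [← e]
    _ ≤ ‖M k‖ + ‖M k - h‖ := norm_sub_le _ _
    _ ≤ ‖M k‖ + ‖Q‖ * ‖M k‖ / m := by linarith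
    _ = (1 + ‖Q‖ / m) * ‖M k‖ := by ring

/-! ## §2. Existence: Lax–Milgram on the closed subspace `ker D` -/

/-- **EXISTENCE**: in a real Hilbert space, a bounded form coercive on `ker D` has on every fibre `{D x = k}` a point
`Q`-orthogonal to `ker D` — namely `M k − z`, where `z ∈ ker D` solves the Lax–Milgram problem `Q z κ = Q (Mk) κ` (`κ ∈ ker D`)
on the closed (hence complete) subspace `ker D`. [folklore] -/
theorem exists_orthogonal_ker [CompleteSpace E] {Q : E →L[ℝ] E →L[ℝ] ℝ} {D : E →L[ℝ] F} {M : F →L[ℝ] E}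
    (hM : ∀ w, D (M w) = w) {m : ℝ} (hm : 0 < m) (hco : ∀ κ, D κ = 0 → m * ‖κ‖ ^ 2 ≤ Q κ κ) (k : F) :
    ∃ h : E, D h = k ∧ ∀ κ, D κ = 0 → Q h κ = 0 := by
  haveI : CompleteSpace D.ker := (ContinuousLinearMap.isClosed_ker D).completeSpace_coe
  have hmemD : ∀ u : D.ker, D (u : E) = 0 := fun u => by
    have hu := u.2
    rw [LinearMap.mem_ker] at hu
    exact hu
  obtain ⟨B, hB_apply⟩ : ∃ B : D.ker →L[ℝ] D.ker →L[ℝ] ℝ, ∀ u w : D.ker, B u w = Q (u : E) (w : E) :=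
    ⟨Q.bilinearComp D.ker.subtypeL D.ker.subtypeL, fun u w => rfl⟩
  have hB : IsCoercive B := by
    refine ⟨m, hm, fun u => ?_⟩
    rw [hB_apply, mul_assoc, ← sq]
    exact hco _ (hmemD u)
  obtain ⟨f, hf_apply⟩ : ∃ f : D.ker →L[ℝ] ℝ, ∀ w : D.ker, f w = Q (M k) (w : E) :=
    ⟨(Q (M k)).comp D.ker.subtypeL, fun w => rfl⟩
  obtain ⟨y, hy⟩ : ∃ y : D.ker, ∀ w : D.ker, @inner ℝ _ _ y w = f w :=
    ⟨(InnerProductSpace.toDual ℝ D.ker).symm f, fun w => InnerProductSpace.toDual_symm_apply⟩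
  obtain ⟨z, hz⟩ : ∃ z : D.ker, hB.continuousLinearEquivOfBilin z = y :=
    ⟨hB.continuousLinearEquivOfBilin.symm y, ContinuousLinearEquiv.apply_symm_apply _ _⟩
  have hBz : ∀ w : D.ker, B z w = Q (M k) (w : E) := fun w => by
    rw [← hB.continuousLinearEquivOfBilin_apply, hz, hy, hf_apply]
  refine ⟨M k - (z : E), by rw [map_sub, hM, hmemD z, sub_zero], fun κ hκ => ?_⟩
  have hκmem : κ ∈ D.ker := LinearMap.mem_ker.mpr hκ
  have h1 := hBz ⟨κ, hκmem⟩
  rw [hB_apply] at h1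
  rw [map_sub Q (M k) (z : E), sub_apply, sub_eq_zero]
  exact h1.symm

/-- EXISTENCE AND UNIQUENESS on each fibre. [folklore] -/
theorem existsUnique_orthogonal_ker [CompleteSpace E] {Q : E →L[ℝ] E →L[ℝ] ℝ} {D : E →L[ℝ] F} {M : F →L[ℝ] E}
    (hM : ∀ w, D (M w) = w) {m : ℝ} (hm : 0 < m) (hco : ∀ κ, D κ = 0 → m * ‖κ‖ ^ 2 ≤ Q κ κ) (k : F) :
    ∃! h : E, D h = k ∧ ∀ κ, D κ = 0 → Q h κ = 0 := by
  obtain ⟨h, hD, horth⟩ := exists_orthogonal_ker hM hm hco k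
  exact ⟨h, ⟨hD, horth⟩, fun y hy => eq_of_orthogonal_ker hm hco (hy.1.trans hD.symm) hy.2 horth⟩

/-! ## §3. The propagator `H` -/

/-- **THE PROPAGATOR**: `∃ H : F →L[ℝ] E` with `D (H k) = k`, `Q (H k) κ = 0` for `κ ∈ ker D`, and `‖H k‖ ≤ (1 + ‖Q‖∕m)·‖M k‖`
— a bounded LINEAR right inverse of `D` selecting the `Q`-orthogonal point of each fibre (linearity from §1's uniqueness,
continuity from §1's bound by `LinearMap.mkContinuous`). [folklore] -/
theorem exists_propagator [CompleteSpace E] {Q : E →L[ℝ] E →L[ℝ] ℝ} {D : E →L[ℝ] F} {M : F →L[ℝ] E}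
    (hM : ∀ w, D (M w) = w) {m : ℝ} (hm : 0 < m) (hco : ∀ κ, D κ = 0 → m * ‖κ‖ ^ 2 ≤ Q κ κ) :
    ∃ H : F →L[ℝ] E, (∀ k, D (H k) = k) ∧ (∀ k κ, D κ = 0 → Q (H k) κ = 0) ∧
      ∀ k, ‖H k‖ ≤ (1 + ‖Q‖ / m) * ‖M k‖ := by
  choose h hD horth using fun k => exists_orthogonal_ker hM hm hco k
  have huniq : ∀ k x, D x = k → (∀ κ, D κ = 0 → Q x κ = 0) → x = h k := fun k x hx hxo =>
    eq_of_orthogonal_ker hm hco (hx.trans (hD k).symm) hxo (horth k)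
  have hadd : ∀ k k', h (k + k') = h k + h k' := by
    intro k k'
    refine (huniq _ _ ?_ ?_).symm
    · rw [map_add, hD, hD]
    · intro κ hκ
      rw [map_add, add_apply, horth k κ hκ, horth k' κ hκ, add_zero]
  have hsmul : ∀ (c : ℝ) (k : F), h (c • k) = c • h k := by
    intro c k
    refine (huniq _ _ ?_ ?_).symm
    · rw [map_smul, hD]
    · intro κ hκ
      rw [map_smul, smul_apply, horth k κ hκ, smul_zero]
  let hlin : F →ₗ[ℝ] E := { toFun := h, map_add' := hadd, map_smul' := hsmul }
  have hbound : ∀ k, ‖hlin k‖ ≤ (1 + ‖Q‖ / m) * ‖M‖ * ‖k‖ := fun k => by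
    have hC : 0 ≤ 1 + ‖Q‖ / m := by positivity
    calc ‖hlin k‖ = ‖h k‖ := rfl
      _ ≤ (1 + ‖Q‖ / m) * ‖M k‖ := norm_le_of_orthogonal_ker hM hm hco (hD k) (horth k)
      _ ≤ (1 + ‖Q‖ / m) * (‖M‖ * ‖k‖) := mul_le_mul_of_nonneg_left (M.le_opNorm k) hC
      _ = (1 + ‖Q‖ / m) * ‖M‖ * ‖k‖ := by ring
  refine ⟨hlin.mkContinuous _ hbound, fun k => ?_, fun k κ hκ => ?_, fun k => ?_⟩
  · rw [LinearMap.mkContinuous_apply]; exact hD k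
  · rw [LinearMap.mkContinuous_apply]; exact horth k κ hκ
  · rw [LinearMap.mkContinuous_apply]; exact norm_le_of_orthogonal_ker hM hm hco (hD k) (horth k)

/-- UNIQUENESS OF THE PROPAGATOR (hence its independence of the right inverse `M` used to bound it): two linear right
inverses of `D` with `Q`-orthogonal values coincide. [folklore] -/
theorem propagator_unique {Q : E →L[ℝ] E →L[ℝ] ℝ} {D : E →L[ℝ] F} {m : ℝ} (hm : 0 < m)
    (hco : ∀ κ, D κ = 0 → m * ‖κ‖ ^ 2 ≤ Q κ κ) {H H' : F →L[ℝ] E} (hH : ∀ k, D (H k) = k)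
    (hHo : ∀ k κ, D κ = 0 → Q (H k) κ = 0) (hH' : ∀ k, D (H' k) = k) (hH'o : ∀ k κ, D κ = 0 → Q (H' k) κ = 0) :
    H = H' := by
  ext k
  exact eq_of_orthogonal_ker hm hco ((hH k).trans (hH' k).symm) (hHo k) (hH'o k)

/-- The operator-norm form of the bound: `‖H‖ ≤ (1 + ‖Q‖∕m)·‖M‖` for any right inverse `M`. [folklore] -/
theorem opNorm_propagator_le {Q : E →L[ℝ] E →L[ℝ] ℝ} {D : E →L[ℝ] F} {M : F →L[ℝ] E} (hM : ∀ w, D (M w) = w)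
    {m : ℝ} (hm : 0 < m) (hco : ∀ κ, D κ = 0 → m * ‖κ‖ ^ 2 ≤ Q κ κ) {H : F →L[ℝ] E} (hH : ∀ k, D (H k) = k)
    (hHo : ∀ k κ, D κ = 0 → Q (H k) κ = 0) : ‖H‖ ≤ (1 + ‖Q‖ / m) * ‖M‖ := by
  have hC : 0 ≤ 1 + ‖Q‖ / m := by positivity
  refine ContinuousLinearMap.opNorm_le_bound _ (by positivity) fun k => ?_
  calc ‖H k‖ ≤ (1 + ‖Q‖ / m) * ‖M k‖ := norm_le_of_orthogonal_ker hM hm hco (hH k) (hHo k)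
    _ ≤ (1 + ‖Q‖ / m) * (‖M‖ * ‖k‖) := mul_le_mul_of_nonneg_left (M.le_opNorm k) hC
    _ = (1 + ‖Q‖ / m) * ‖M‖ * ‖k‖ := by ring

/-! ## §4. The chart `x = (x − H D x) + H D x` ([B11] (47) in abstract currency) -/

/-- `x − H(Dx) ∈ ker D` for any right inverse `H`. [folklore] -/
theorem sub_propagator_mem_ker {D : E →L[ℝ] F} {H : F →L[ℝ] E} (hH : ∀ k, D (H k) = k) (x : E) :
    D (x - H (D x)) = 0 := by
  rw [map_sub, hH, sub_self]

/-- The splitting `E = range H ⊕ ker D` is `Q`-ORTHOGONAL: `Q (H(Dx)) (x − H(Dx)) = 0`. [folklore] -/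
theorem propagator_orthogonal_split {Q : E →L[ℝ] E →L[ℝ] ℝ} {D : E →L[ℝ] F} {H : F →L[ℝ] E} (hH : ∀ k, D (H k) = k)
    (hHo : ∀ k κ, D κ = 0 → Q (H k) κ = 0) (x : E) : Q (H (D x)) (x - H (D x)) = 0 :=
  hHo _ _ (sub_propagator_mem_ker hH x)

/-- For SYMMETRIC `Q` the form SPLITS along the chart: `Q x x = Q (HDx)(HDx) + Q (x − HDx)(x − HDx)`. [folklore] -/
theorem form_split {Q : E →L[ℝ] E →L[ℝ] ℝ} {D : E →L[ℝ] F} {H : F →L[ℝ] E} (hsymm : ∀ x y, Q x y = Q y x)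
    (hH : ∀ k, D (H k) = k) (hHo : ∀ k κ, D κ = 0 → Q (H k) κ = 0) (x : E) :
    Q x x = Q (H (D x)) (H (D x)) + Q (x - H (D x)) (x - H (D x)) := by
  have h0 := propagator_orthogonal_split hH hHo x
  have e : Q x x = Q (H (D x)) (H (D x)) + 2 * Q (H (D x)) (x - H (D x)) + Q (x - H (D x)) (x - H (D x)) := by
    simp only [map_sub, sub_apply]
    rw [hsymm x (H (D x))]
    ring
  rw [e, h0, mul_zero, add_zero]

/-! ## §5. Toy -/

/-- Toy: `E = F = ℝ`, `D = M = id`, `Q x y = x·y` (`m = 1`): the fibre `{x = k}` is the point `k`, trivially `Q`-orthogonal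
to `ker D = 0`, and §1's bound reads `‖k‖ ≤ (1 + ‖Q‖∕1)·‖k‖`. [folklore] -/
example (k : ℝ) : ‖k‖ ≤ (1 + ‖ContinuousLinearMap.mul ℝ ℝ‖ / 1) * ‖(ContinuousLinearMap.id ℝ ℝ) k‖ :=
  norm_le_of_orthogonal_ker (Q := ContinuousLinearMap.mul ℝ ℝ) (D := ContinuousLinearMap.id ℝ ℝ)
    (M := ContinuousLinearMap.id ℝ ℝ) (fun w => rfl) one_pos
    (fun κ hκ => by simp [show κ = 0 from hκ]) rfl
    (fun κ hκ => by simp [show κ = 0 from hκ])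

end Summit.QuantumFields.BalabanUV.T4Continuum.NE7b.QuadraticFibreMinimiser
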